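import Summits.AtomisticToContinuum.Crystallization.Theorems.OverbindingBudgetAffineLayerSymmetry

/-!
# Overbinding budget, affine far-core cell (31280 Z2): first-order (gradient) label parity of the layer sums
# at axial shapes — `layerLin X E n k (−o) = layerLin X E n k o`

(decomp-a2c lens-4, generation 66, item (III)(b) of memo NODE-g65 §8; second half of the symmetry module, split at
400 lines.)  Imports `…LayerSymmetry` (§S1–§S4: the maps `rotR`, `rotR'`, the Literature half-turn `halfTurnLinear`, transport and zeroth-order parity);
restates nothing.  PROVED, 0 sorry (certified inlined in probe `TowerG66.lean`, rc 0).

* §S5 linear algebra of the point group: `R² = R'`, `R³ = 1`, `v + Rv + R²v = (0,0,3v₃)`, `PR = RP`, the coordinate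
  expansion `eq_sum_basis`, and the ★ rigidity lemma `eq_zero_of_rotR_comm_of_rotP_anti`: `AR = RA ∧ PAP = −A ⇒ A = 0`.
* §S6 the coefficient functional `layerLin X E n k o = Σ'_{(i,j)} ‖Xv‖^{−(n+2)} ⟪Xv, Ev⟫` (`v = layerVec i j o k`;
  `−n ×` it is the `E`-derivative of `layerSum (X+E) n k o` at `E = 0`): additivity / negation, summability from that
  of `layerTerm X n k o` when `‖v‖ ≤ K‖Xv‖` (`summable_layerLinTerm`; `norm_le_mul_norm_diag3` supplies `K` for
  `diag(a,a,c)`), `P`-transport `layerLin X E n k (−o) = layerLin X (PEP) n k o` (`X P = P X`), `R`-conjugation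
  invariance `layerLin X (R'ER) = layerLin X E` (`X R = R X`), and ★ `layerLin_neg_label`: for `X` commuting with `R`
  and `P` and all first-order families summable, `layerLin X E n k (−o) = layerLin X E n k o` for EVERY direction `E`.
  Consequence (memo §8 (II)/(III)): at an axial `X°` the gradients of two layerwise `±`-aligned window energies
  coincide; their difference is `O(‖B − X°‖²)` with the g64/g65 second-variation constants.

Method: `P`-transport reduces `layerLin E (o) − layerLin E (−o)` to `layerLin F (o)` for the `P`-odd part `F = E − PEP`;
`R`-transport gives `3·layerLin F = layerLin F̄`, `F̄ = F + R'FR + R'²FR²`, which commutes with `R` and is `P`-odd, so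
`F̄ = 0` by rigidity (block form `(αI + βJ) ⊕ γ` is centralised by `P = (−I) ⊕ 1`).
-/

namespace Summit.AtomisticToContinuum.Crystallization.Theorems.OverbindingBudgetAffineFarSmoothSplit

open scoped BigOperators Classical
open Literature.MathematicalPhysics.StatisticalMechanics

local notation "E3" => EuclideanSpace ℝ (Fin 3)

-- PRIVATE copies (landing lane): these helpers are `private` in `OverbindingBudgetAffineLayerSymmetry` (dedup gate), so each consumer module carries its own private copy.
/-- `norm_sq_eq_three` (docstring added by the landing lane; see the module docstring). [formal bookkeeping] -/
private theorem norm_sq_eq_three (v : E3) : ‖v‖ ^ 2 = v 0 ^ 2 + v 1 ^ 2 + v 2 ^ 2 := by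
  rw [EuclideanSpace.norm_eq, Real.sq_sqrt (Finset.sum_nonneg fun i _ => by positivity), Fin.sum_univ_three]
  simp only [Real.norm_eq_abs, sq_abs]

/-- `sqrt3_sq` (docstring added by the landing lane; see the module docstring). [formal bookkeeping] -/
private theorem sqrt3_sq : Real.sqrt 3 ^ 2 = 3 := Real.sq_sqrt (by norm_num)

/-! ## §S5 Linear algebra of the point group: `R³ = 1`, `1 + R + R² = 3·(e₃ ⊗ e₃)`, `P R = R P`, and the rigidity lemma -/

/-- `rotR_rotR_apply_zero` (docstring added by the landing lane; see the module docstring). [formal bookkeeping] -/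
theorem rotR_rotR_apply_zero (v : E3) : rotR (rotR v) 0 = -(1 / 2) * v 0 + Real.sqrt 3 / 2 * v 1 := by
  simp only [rotR_apply_zero, rotR_apply_one]; linear_combination (-(1 / 4) * v 0) * sqrt3_sq

/-- `rotR_rotR_apply_one` (docstring added by the landing lane; see the module docstring). [formal bookkeeping] -/
theorem rotR_rotR_apply_one (v : E3) : rotR (rotR v) 1 = -(Real.sqrt 3 / 2) * v 0 - (1 / 2) * v 1 := by
  simp only [rotR_apply_zero, rotR_apply_one]; linear_combination (-(1 / 4) * v 1) * sqrt3_sq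

/-- `rotR_rotR_apply_two` (docstring added by the landing lane; see the module docstring). [formal bookkeeping] -/
theorem rotR_rotR_apply_two (v : E3) : rotR (rotR v) 2 = v 2 := rfl

/-- `R² = R'` (so `R'` is both the square and the inverse of `R`). [this file] -/
theorem rotR_rotR (v : E3) : rotR (rotR v) = rotR' v := by
  ext l; fin_cases l
  · exact rotR_rotR_apply_zero v
  · exact rotR_rotR_apply_one v
  · rfl

/-- `R³ = 1`. [this file] -/
theorem rotR_three (v : E3) : rotR (rotR (rotR v)) = v := by
  rw [rotR_rotR]; exact LinearMap.congr_fun rotR'_comp_rotR v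

/-- `rotR'_rotR` (docstring added by the landing lane; see the module docstring). [formal bookkeeping] -/
theorem rotR'_rotR (v : E3) : rotR' (rotR v) = v := LinearMap.congr_fun rotR'_comp_rotR v
/-- `rotR_rotR'` (docstring added by the landing lane; see the module docstring). [formal bookkeeping] -/
theorem rotR_rotR' (v : E3) : rotR (rotR' v) = v := LinearMap.congr_fun rotR_comp_rotR' v
/-- `rotP_rotP` (docstring added by the landing lane; see the module docstring). [formal bookkeeping] -/
theorem rotP_rotP (v : E3) : halfTurnLinear (halfTurnLinear v) = v := LinearMap.congr_fun halfTurnLinear_comp_self v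

/-- `v + R v + R² v = (0, 0, 3 v₃)`. [this file] -/
theorem add_rotR_add_rotR_rotR (v : E3) :
    (v + rotR v + rotR (rotR v)) 0 = 0 ∧ (v + rotR v + rotR (rotR v)) 1 = 0 ∧ (v + rotR v + rotR (rotR v)) 2 = 3 * v 2 := by
  refine ⟨?_, ?_, ?_⟩
  · rw [PiLp.add_apply, PiLp.add_apply, rotR_rotR_apply_zero, rotR_apply_zero]; ring
  · rw [PiLp.add_apply, PiLp.add_apply, rotR_rotR_apply_one, rotR_apply_one]; ring
  · rw [PiLp.add_apply, PiLp.add_apply, rotR_rotR_apply_two, rotR_apply_two]; ring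

/-- `P R = R P`. [this file] -/
theorem rotP_rotR (v : E3) : halfTurnLinear (rotR v) = rotR (halfTurnLinear v) := by
  ext l; fin_cases l
  · show halfTurnLinear (rotR v) 0 = rotR (halfTurnLinear v) 0
    simp only [halfTurnLinear_apply_zero, rotR_apply_zero, halfTurnLinear_apply_one]; ring
  · show halfTurnLinear (rotR v) 1 = rotR (halfTurnLinear v) 1
    simp only [halfTurnLinear_apply_one, rotR_apply_one, halfTurnLinear_apply_zero]; ring
  · rfl

/-- `rotP_rotR'` (docstring added by the landing lane; see the module docstring). [formal bookkeeping] -/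
theorem rotP_rotR' (v : E3) : halfTurnLinear (rotR' v) = rotR' (halfTurnLinear v) := by
  rw [← rotR_rotR, ← rotR_rotR, rotP_rotR, rotP_rotR]

/-- The standard basis vectors and the coordinate expansion. -/
theorem eq_sum_basis (v : E3) :
    v = (v 0) • (EuclideanSpace.single 0 1 : E3) + (v 1) • EuclideanSpace.single 1 1 + (v 2) • EuclideanSpace.single 2 1 := by
  ext l; fin_cases l <;> simp

/-- ★ **Rigidity**: a linear map commuting with the rotation `R` and ANTI-commuting with `P` under conjugation (`P A P = −A`) vanishes
(`A R = R A` forces `A = (αI + βJ) ⊕ γ` — block form w.r.t. plane ⊕ axis — which `P = (−I) ⊕ 1` centralises). [this file] -/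
theorem eq_zero_of_rotR_comm_of_rotP_anti (A : E3 →ₗ[ℝ] E3) (hR : ∀ v, A (rotR v) = rotR (A v))
    (hP : ∀ v, halfTurnLinear (A (halfTurnLinear v)) = -A v) : A = 0 := by
  -- averaging identity: `A (v + Rv + R²v) = Av + R(Av) + R²(Av)`
  have key : ∀ v : E3, A (v + rotR v + rotR (rotR v)) = A v + rotR (A v) + rotR (rotR (A v)) := by
    intro v; rw [map_add, map_add, hR, hR, hR]
  set e0 : E3 := EuclideanSpace.single 0 1
  set e1 : E3 := EuclideanSpace.single 1 1
  set e2 : E3 := EuclideanSpace.single 2 1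
  have he0 : e0 0 = 1 ∧ e0 1 = 0 ∧ e0 2 = 0 := by simp [e0]
  have he1 : e1 0 = 0 ∧ e1 1 = 1 ∧ e1 2 = 0 := by simp [e1]
  have he2 : e2 0 = 0 ∧ e2 1 = 0 ∧ e2 2 = 1 := by simp [e2]
  -- a vector with vanishing first two coordinates and third coordinate `3c` is `(3c) • e2`
  have hvec : ∀ (w : E3) (c : ℝ), w 0 = 0 → w 1 = 0 → w 2 = 3 * c → w = (3 * c) • e2 := by
    intro w c h0 h1 h2; ext l; fin_cases l
    · show w 0 = ((3 * c) • e2) 0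
      rw [PiLp.smul_apply, he2.1, h0, smul_eq_mul, mul_zero]
    · show w 1 = ((3 * c) • e2) 1
      rw [PiLp.smul_apply, he2.2.1, h1, smul_eq_mul, mul_zero]
    · show w 2 = ((3 * c) • e2) 2
      rw [PiLp.smul_apply, he2.2.2, h2, smul_eq_mul, mul_one]
  have hin : ∀ v : E3, v + rotR v + rotR (rotR v) = (3 * v 2) • e2 := fun v =>
    hvec _ _ (add_rotR_add_rotR_rotR v).1 (add_rotR_add_rotR_rotR v).2.1 (add_rotR_add_rotR_rotR v).2.2
  have hout : ∀ v : E3, A v + rotR (A v) + rotR (rotR (A v)) = (3 * A v 2) • e2 := fun v =>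
    hvec _ _ (add_rotR_add_rotR_rotR (A v)).1 (add_rotR_add_rotR_rotR (A v)).2.1 (add_rotR_add_rotR_rotR (A v)).2.2
  have key' : ∀ v : E3, (3 * v 2) • A e2 = (3 * A v 2) • e2 := by
    intro v; rw [← map_smul, ← hin, key, hout]
  -- third coordinates of `A e0`, `A e1` vanish; first two of `A e2` vanish
  have c0 : A e0 2 = 0 := by
    have h := congrArg (fun w : E3 => w 2) (key' e0)
    simp only [PiLp.smul_apply, smul_eq_mul, he0.2.2, he2.2.2] at h
    linarith
  have c1 : A e1 2 = 0 := by
    have h := congrArg (fun w : E3 => w 2) (key' e1)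
    simp only [PiLp.smul_apply, smul_eq_mul, he1.2.2, he2.2.2] at h
    linarith
  have c2 : A e2 0 = 0 ∧ A e2 1 = 0 := by
    have h0 := congrArg (fun w : E3 => w 0) (key' e2)
    have h1 := congrArg (fun w : E3 => w 1) (key' e2)
    simp only [PiLp.smul_apply, smul_eq_mul, he2.1, he2.2.1, he2.2.2] at h0 h1
    constructor <;> linarith
  -- `P`-oddness kills the remaining entries
  have hPe0 : halfTurnLinear e0 = -e0 := by ext l; fin_cases l <;> simp [e0]
  have hPe1 : halfTurnLinear e1 = -e1 := by ext l; fin_cases l <;> simp [e1]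
  have hPe2 : halfTurnLinear e2 = e2 := by ext l; fin_cases l <;> simp [e2]
  have d0 : A e0 0 = 0 ∧ A e0 1 = 0 := by
    have h := hP e0
    rw [hPe0, map_neg, map_neg, neg_inj] at h
    have h0 := congrArg (fun w : E3 => w 0) h
    have h1 := congrArg (fun w : E3 => w 1) h
    simp only [halfTurnLinear_apply_zero, halfTurnLinear_apply_one] at h0 h1
    constructor <;> linarith
  have d1 : A e1 0 = 0 ∧ A e1 1 = 0 := by
    have h := hP e1
    rw [hPe1, map_neg, map_neg, neg_inj] at h
    have h0 := congrArg (fun w : E3 => w 0) h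
    have h1 := congrArg (fun w : E3 => w 1) h
    simp only [halfTurnLinear_apply_zero, halfTurnLinear_apply_one] at h0 h1
    constructor <;> linarith
  have d2 : A e2 2 = 0 := by
    have h := hP e2
    rw [hPe2] at h
    have h2 := congrArg (fun w : E3 => w 2) h
    simp only [halfTurnLinear_apply_two, PiLp.neg_apply] at h2
    linarith
  have z0 : A e0 = 0 := by
    ext l; fin_cases l
    · exact d0.1
    · exact d0.2
    · exact c0
  have z1 : A e1 = 0 := by
    ext l; fin_cases l
    · exact d1.1
    · exact d1.2
    · exact c1
  have z2 : A e2 = 0 := by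
    ext l; fin_cases l
    · exact c2.1
    · exact c2.2
    · exact d2
  apply LinearMap.ext; intro v
  rw [eq_sum_basis v, map_add, map_add, map_smul, map_smul, map_smul]
  change v 0 • A e0 + v 1 • A e1 + v 2 • A e2 = 0
  rw [z0, z1, z2, smul_zero, smul_zero, smul_zero, add_zero, add_zero]

/-! ## §S6 The first-order (gradient) coefficient of a layer sum and its label parity for axial shapes -/

/-- The first-order coefficient term `‖X v‖^{−(n+2)} ⟪X v, E v⟫` at the layer point `v = layerVec i j o k`
(`−n ×` this is the `E`-derivative of `‖(X + E) v‖⁻ⁿ` at `E = 0`). -/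
noncomputable def layerLinTerm (X E : E3 →ₗ[ℝ] E3) (n : ℕ) (k o : ℤ) (ij : ℤ × ℤ) : ℝ :=
  (‖X (layerVec ij.1 ij.2 o k)‖)⁻¹ ^ (n + 2) * inner ℝ (X (layerVec ij.1 ij.2 o k)) (E (layerVec ij.1 ij.2 o k))

/-- The first-order coefficient functional `E ↦ Σ'_{(i,j)} ‖X v‖^{−(n+2)} ⟪X v, E v⟫` of the layer sum of layer `k`, label `o`. -/
noncomputable def layerLin (X E : E3 →ₗ[ℝ] E3) (n : ℕ) (k o : ℤ) : ℝ :=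
  ∑' ij : ℤ × ℤ, layerLinTerm X E n k o ij

/-- `layerLinTerm_add` (docstring added by the landing lane; see the module docstring). [formal bookkeeping] -/
theorem layerLinTerm_add (X E₁ E₂ : E3 →ₗ[ℝ] E3) (n : ℕ) (k o : ℤ) (ij : ℤ × ℤ) :
    layerLinTerm X (E₁ + E₂) n k o ij = layerLinTerm X E₁ n k o ij + layerLinTerm X E₂ n k o ij := by
  simp only [layerLinTerm, LinearMap.add_apply, inner_add_right, mul_add]

/-- `layerLinTerm_neg` (docstring added by the landing lane; see the module docstring). [formal bookkeeping] -/
theorem layerLinTerm_neg (X E : E3 →ₗ[ℝ] E3) (n : ℕ) (k o : ℤ) (ij : ℤ × ℤ) :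
    layerLinTerm X (-E) n k o ij = -layerLinTerm X E n k o ij := by
  simp only [layerLinTerm, LinearMap.neg_apply, inner_neg_right, mul_neg]

/-- `layerLinTerm_zero` (docstring added by the landing lane; see the module docstring). [formal bookkeeping] -/
theorem layerLinTerm_zero (X : E3 →ₗ[ℝ] E3) (n : ℕ) (k o : ℤ) (ij : ℤ × ℤ) : layerLinTerm X 0 n k o ij = 0 := by
  simp only [layerLinTerm, LinearMap.zero_apply, inner_zero_right, mul_zero]

/-- `summable_layerLinTerm_add` (docstring added by the landing lane; see the module docstring). [formal bookkeeping] -/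
theorem summable_layerLinTerm_add {X E₁ E₂ : E3 →ₗ[ℝ] E3} {n : ℕ} {k o : ℤ} (h₁ : Summable (layerLinTerm X E₁ n k o))
    (h₂ : Summable (layerLinTerm X E₂ n k o)) : Summable (layerLinTerm X (E₁ + E₂) n k o) := by
  have : layerLinTerm X (E₁ + E₂) n k o = fun ij => layerLinTerm X E₁ n k o ij + layerLinTerm X E₂ n k o ij :=
    funext fun ij => layerLinTerm_add X E₁ E₂ n k o ij
  rw [this]; exact h₁.add h₂

/-- `summable_layerLinTerm_neg` (docstring added by the landing lane; see the module docstring). [formal bookkeeping] -/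
theorem summable_layerLinTerm_neg {X E : E3 →ₗ[ℝ] E3} {n : ℕ} {k o : ℤ} (h : Summable (layerLinTerm X E n k o)) :
    Summable (layerLinTerm X (-E) n k o) := by
  have : layerLinTerm X (-E) n k o = fun ij => -layerLinTerm X E n k o ij := funext fun ij => layerLinTerm_neg X E n k o ij
  rw [this]; exact h.neg

/-- `layerLin_add` (docstring added by the landing lane; see the module docstring). [formal bookkeeping] -/
theorem layerLin_add {X E₁ E₂ : E3 →ₗ[ℝ] E3} {n : ℕ} {k o : ℤ} (h₁ : Summable (layerLinTerm X E₁ n k o))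
    (h₂ : Summable (layerLinTerm X E₂ n k o)) : layerLin X (E₁ + E₂) n k o = layerLin X E₁ n k o + layerLin X E₂ n k o := by
  unfold layerLin; simp only [layerLinTerm_add]; exact h₁.tsum_add h₂

/-- `layerLin_neg` (docstring added by the landing lane; see the module docstring). [formal bookkeeping] -/
theorem layerLin_neg (X E : E3 →ₗ[ℝ] E3) (n : ℕ) (k o : ℤ) : layerLin X (-E) n k o = -layerLin X E n k o := by
  unfold layerLin; simp only [layerLinTerm_neg]; exact tsum_neg

/-- `layerLin_zero` (docstring added by the landing lane; see the module docstring). [formal bookkeeping] -/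
theorem layerLin_zero (X : E3 →ₗ[ℝ] E3) (n : ℕ) (k o : ℤ) : layerLin X 0 n k o = 0 := by
  unfold layerLin; simp only [layerLinTerm_zero, tsum_zero]

/-- **Summability of the first-order terms** from that of the layer terms: `|‖Xv‖^{−(n+2)} ⟪Xv, Ev⟫| ≤ K ‖E‖ ‖Xv‖⁻ⁿ` when `‖v‖ ≤ K ‖X v‖`. [this file] -/
theorem summable_layerLinTerm {X : E3 →ₗ[ℝ] E3} {K : ℝ} (hK : ∀ v, ‖v‖ ≤ K * ‖X v‖) (E : E3 →ₗ[ℝ] E3) {n : ℕ} {k o : ℤ}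
    (hs : Summable (layerTerm X n k o)) : Summable (layerLinTerm X E n k o) := by
  have hK0 : 0 ≤ K := by
    by_contra h
    rw [not_le] at h
    have h1 := hK (EuclideanSpace.single 0 1)
    have h2 : ‖(EuclideanSpace.single 0 1 : E3)‖ = 1 := by simp
    rw [h2] at h1
    nlinarith [norm_nonneg (X (EuclideanSpace.single 0 1 : E3))]
  set M : ℝ := ‖LinearMap.toContinuousLinearMap E‖ with hM
  have hEv : ∀ v : E3, ‖E v‖ ≤ M * ‖v‖ := fun v => (LinearMap.toContinuousLinearMap E).le_opNorm v
  refine Summable.of_norm_bounded (hs.mul_left (K * M)) fun ij => ?_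
  rw [Real.norm_eq_abs, layerLinTerm, layerTerm, abs_mul, abs_of_nonneg (by positivity)]
  set v := layerVec ij.1 ij.2 o k
  by_cases hv : X v = 0
  · rw [hv, norm_zero, inv_zero, zero_pow (by omega), zero_mul]; positivity
  · have hpos : 0 < ‖X v‖ := norm_pos_iff.2 hv
    have hcs : |inner ℝ (X v) (E v)| ≤ ‖X v‖ * ‖E v‖ := abs_real_inner_le_norm _ _
    have hE' : ‖E v‖ ≤ M * (K * ‖X v‖) := (hEv v).trans (mul_le_mul_of_nonneg_left (hK v) (norm_nonneg _))
    calc ‖X v‖⁻¹ ^ (n + 2) * |inner ℝ (X v) (E v)| ≤ ‖X v‖⁻¹ ^ (n + 2) * (‖X v‖ * (M * (K * ‖X v‖))) :=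
          mul_le_mul_of_nonneg_left (hcs.trans (mul_le_mul_of_nonneg_left hE' hpos.le)) (by positivity)
      _ = K * M * ‖X v‖⁻¹ ^ n := by
          have hne : ‖X v‖ ≠ 0 := hpos.ne'
          rw [pow_add, inv_pow, inv_pow]
          field_simp

/-- **Transport by `P`**: for a shape commuting with `P`, the label-`(−o)` functional is the label-`o` functional of the conjugate direction
`P E P`. [this file] -/
theorem layerLin_neg_label_eq_conj {X : E3 →ₗ[ℝ] E3} (hP : X ∘ₗ halfTurnLinear = halfTurnLinear ∘ₗ X) (E : E3 →ₗ[ℝ] E3) (n : ℕ) (k o : ℤ) :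
    layerLin X E n k (-o) = layerLin X (halfTurnLinear ∘ₗ E ∘ₗ halfTurnLinear) n k o := by
  unfold layerLin
  have hXP : ∀ u, X (halfTurnLinear u) = halfTurnLinear (X u) := fun u => LinearMap.congr_fun hP u
  have h : ∀ ij : ℤ × ℤ, layerLinTerm X E n k (-o) ij =
      layerLinTerm X (halfTurnLinear ∘ₗ E ∘ₗ halfTurnLinear) n k o ((Equiv.prodCongr (Equiv.neg ℤ) (Equiv.neg ℤ)) ij) := fun ij => by
    show (‖X (layerVec ij.1 ij.2 (-o) k)‖)⁻¹ ^ (n + 2) * inner ℝ (X (layerVec ij.1 ij.2 (-o) k)) (E (layerVec ij.1 ij.2 (-o) k)) =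
      (‖X (layerVec (-ij.1) (-ij.2) o k)‖)⁻¹ ^ (n + 2) *
        inner ℝ (X (layerVec (-ij.1) (-ij.2) o k)) ((halfTurnLinear ∘ₗ E ∘ₗ halfTurnLinear) (layerVec (-ij.1) (-ij.2) o k))
    have hv : layerVec ij.1 ij.2 (-o) k = halfTurnLinear (layerVec (-ij.1) (-ij.2) o k) := by
      rw [rotP_layerVec]; simp only [neg_neg]
    rw [hv, hXP, norm_halfTurnLinear, LinearMap.comp_apply, LinearMap.comp_apply, inner_rotP_left]
  rw [tsum_congr h]
  exact (Equiv.prodCongr (Equiv.neg ℤ) (Equiv.neg ℤ)).tsum_eq (layerLinTerm X (halfTurnLinear ∘ₗ E ∘ₗ halfTurnLinear) n k o)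

/-- **Transport by `R`**: for a shape commuting with `R`, the functional is invariant under the conjugation `E ↦ R' E R`. [this file] -/
theorem layerLin_conj_rotR {X : E3 →ₗ[ℝ] E3} (hR : X ∘ₗ rotR = rotR ∘ₗ X) (E : E3 →ₗ[ℝ] E3) (n : ℕ) (k o : ℤ) :
    layerLin X (rotR' ∘ₗ E ∘ₗ rotR) n k o = layerLin X E n k o := by
  unfold layerLin
  have hXR : ∀ u, X (rotR u) = rotR (X u) := fun u => LinearMap.congr_fun hR u
  have h : ∀ ij : ℤ × ℤ, layerLinTerm X (rotR' ∘ₗ E ∘ₗ rotR) n k o ij = layerLinTerm X E n k o (rotIdx o ij) := fun ij => by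
    show (‖X (layerVec ij.1 ij.2 o k)‖)⁻¹ ^ (n + 2) *
        inner ℝ (X (layerVec ij.1 ij.2 o k)) ((rotR' ∘ₗ E ∘ₗ rotR) (layerVec ij.1 ij.2 o k)) =
      (‖X (layerVec (-ij.1 - ij.2 - o) ij.1 o k)‖)⁻¹ ^ (n + 2) *
        inner ℝ (X (layerVec (-ij.1 - ij.2 - o) ij.1 o k)) (E (layerVec (-ij.1 - ij.2 - o) ij.1 o k))
    rw [← rotR_layerVec, hXR, norm_rotR, inner_rotR_left, LinearMap.comp_apply, LinearMap.comp_apply]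
  rw [tsum_congr h]
  exact (rotIdx o).tsum_eq (layerLinTerm X E n k o)

/-- ★ **First-order label parity** (memo §8 (III)(b)): for an AXIAL shape `X` (commuting with the rotation `R` and the half-turn `P` about
`e₃` — e.g. `X° = diag(a, a, c)`), the first-order coefficient functionals of the layers `(k, o)` and `(k, −o)` COINCIDE:
`layerLin X E n k (−o) = layerLin X E n k o` for every direction `E` (given summability of the first-order families, e.g. from
`summable_layerLinTerm`).  Consequently the gradients at `X°` of the window energies of two windows that are layerwise `±`-aligned agree
(memo §8 (II): the near bracket of an aligned window is second order).  Proof: by `P`-transport the difference is the functional of the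
`P`-odd part `F = E − PEP`; by `R`-transport `3·layerLin(F) = layerLin(F̄)` with `F̄` the `C₃`-average, which commutes with `R` and is `P`-odd,
hence `F̄ = 0` by the rigidity lemma. [this file] -/
theorem layerLin_neg_label {X : E3 →ₗ[ℝ] E3} (hR : X ∘ₗ rotR = rotR ∘ₗ X) (hP : X ∘ₗ halfTurnLinear = halfTurnLinear ∘ₗ X) {n : ℕ} {k o : ℤ}
    (hs : ∀ E : E3 →ₗ[ℝ] E3, Summable (layerLinTerm X E n k o)) (E : E3 →ₗ[ℝ] E3) :
    layerLin X E n k (-o) = layerLin X E n k o := by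
  -- the `P`-odd part `F`
  set F : E3 →ₗ[ℝ] E3 := E + -(halfTurnLinear ∘ₗ E ∘ₗ halfTurnLinear) with hF
  have hFodd : ∀ v, halfTurnLinear (F (halfTurnLinear v)) = -F v := by
    intro v
    simp only [hF, LinearMap.add_apply, LinearMap.neg_apply, LinearMap.comp_apply, map_add, map_neg, rotP_rotP]
    abel
  have h1 : layerLin X E n k o - layerLin X E n k (-o) = layerLin X F n k o := by
    rw [layerLin_neg_label_eq_conj hP, hF, layerLin_add (hs E) (summable_layerLinTerm_neg (hs _)), layerLin_neg, sub_eq_add_neg]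
  -- the `C₃`-average `Fbar`
  set F₁ : E3 →ₗ[ℝ] E3 := rotR' ∘ₗ F ∘ₗ rotR with hF₁
  set F₂ : E3 →ₗ[ℝ] E3 := rotR' ∘ₗ F₁ ∘ₗ rotR with hF₂
  set Fbar : E3 →ₗ[ℝ] E3 := F + F₁ + F₂ with hFbar
  have hc1 : layerLin X F₁ n k o = layerLin X F n k o := by rw [hF₁]; exact layerLin_conj_rotR hR F n k o
  have hc2 : layerLin X F₂ n k o = layerLin X F₁ n k o := by rw [hF₂]; exact layerLin_conj_rotR hR F₁ n k o
  have h2 : layerLin X Fbar n k o = 3 * layerLin X F n k o := by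
    rw [hFbar, layerLin_add (summable_layerLinTerm_add (hs F) (hs F₁)) (hs F₂), layerLin_add (hs F) (hs F₁), hc2, hc1]
    ring
  -- `Fbar` commutes with `R` …
  have hF₁v : ∀ v, F₁ v = rotR (rotR (F (rotR v))) := fun v => by
    simp only [hF₁, LinearMap.comp_apply, rotR_rotR]
  have hF₂v : ∀ v, F₂ v = rotR (F (rotR (rotR v))) := fun v => by
    simp only [hF₂, LinearMap.comp_apply, hF₁v, ← rotR_rotR, rotR_three]
  have hcommR : ∀ v, Fbar (rotR v) = rotR (Fbar v) := by
    intro v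
    simp only [hFbar, LinearMap.add_apply, hF₁v, hF₂v, map_add, rotR_three]
    abel
  -- … and is `P`-odd
  have hPRR : ∀ x, halfTurnLinear (rotR (rotR x)) = rotR (rotR (halfTurnLinear x)) := fun x => by rw [rotP_rotR, rotP_rotR]
  have hPodd : ∀ v, halfTurnLinear (Fbar (halfTurnLinear v)) = -Fbar v := by
    intro v
    have e1 : halfTurnLinear (F₁ (halfTurnLinear v)) = -F₁ v :=
      calc halfTurnLinear (F₁ (halfTurnLinear v)) = halfTurnLinear (rotR (rotR (F (rotR (halfTurnLinear v))))) := by rw [hF₁v]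
        _ = rotR (rotR (halfTurnLinear (F (halfTurnLinear (rotR v))))) := by rw [hPRR, ← rotP_rotR v]
        _ = -F₁ v := by rw [hFodd, map_neg, map_neg, hF₁v]
    have e2 : halfTurnLinear (F₂ (halfTurnLinear v)) = -F₂ v :=
      calc halfTurnLinear (F₂ (halfTurnLinear v)) = halfTurnLinear (rotR (F (rotR (rotR (halfTurnLinear v))))) := by rw [hF₂v]
        _ = rotR (halfTurnLinear (F (halfTurnLinear (rotR (rotR v))))) := by rw [← hPRR v, rotP_rotR (F (halfTurnLinear (rotR (rotR v))))]
        _ = -F₂ v := by rw [hFodd, map_neg, hF₂v]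
    simp only [hFbar, LinearMap.add_apply, map_add, hFodd, e1, e2]
    abel
  have hzero : Fbar = 0 := eq_zero_of_rotR_comm_of_rotP_anti Fbar hcommR hPodd
  have h3 : layerLin X F n k o = 0 := by
    have := h2; rw [hzero, layerLin_zero] at this; linarith
  linarith [h1, h3]

/-- The axial family `diag(a, a, c)` with `a, c ≠ 0` is bounded below (`‖v‖ ≤ max(|a|⁻¹, |c|⁻¹) ‖X v‖`), so its first-order families are
summable wherever its layer terms are. [this file] -/
theorem norm_le_mul_norm_diag3 {a c : ℝ} (ha : a ≠ 0) (hc : c ≠ 0) (v : E3) :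
    ‖v‖ ≤ max |a|⁻¹ |c|⁻¹ * ‖diag3 a c v‖ := by
  set K := max |a|⁻¹ |c|⁻¹ with hK
  have hK0 : 0 ≤ K := le_max_of_le_left (inv_nonneg.2 (abs_nonneg a))
  have hKa : 1 ≤ K * |a| := by
    have : |a|⁻¹ ≤ K := le_max_left _ _
    calc (1 : ℝ) = |a|⁻¹ * |a| := (inv_mul_cancel₀ (abs_ne_zero.2 ha)).symm
      _ ≤ K * |a| := mul_le_mul_of_nonneg_right this (abs_nonneg a)
  have hKc : 1 ≤ K * |c| := by
    have : |c|⁻¹ ≤ K := le_max_right _ _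
    calc (1 : ℝ) = |c|⁻¹ * |c| := (inv_mul_cancel₀ (abs_ne_zero.2 hc)).symm
      _ ≤ K * |c| := mul_le_mul_of_nonneg_right this (abs_nonneg c)
  have hsq : ‖v‖ ^ 2 ≤ (K * ‖diag3 a c v‖) ^ 2 := by
    rw [mul_pow, norm_sq_eq_three, norm_sq_eq_three, diag3_apply_zero, diag3_apply_one, diag3_apply_two, mul_pow, mul_pow, mul_pow,
      ← sq_abs a, ← sq_abs c]
    have hKa2 : 1 ≤ (K * |a|) ^ 2 := one_le_pow₀ hKa
    have hKc2 : 1 ≤ (K * |c|) ^ 2 := one_le_pow₀ hKc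
    have h0 : v 0 ^ 2 ≤ K ^ 2 * (|a| ^ 2 * v 0 ^ 2) := by
      rw [show K ^ 2 * (|a| ^ 2 * v 0 ^ 2) = (K * |a|) ^ 2 * v 0 ^ 2 by ring]; exact le_mul_of_one_le_left (sq_nonneg _) hKa2
    have h1 : v 1 ^ 2 ≤ K ^ 2 * (|a| ^ 2 * v 1 ^ 2) := by
      rw [show K ^ 2 * (|a| ^ 2 * v 1 ^ 2) = (K * |a|) ^ 2 * v 1 ^ 2 by ring]; exact le_mul_of_one_le_left (sq_nonneg _) hKa2
    have h2 : v 2 ^ 2 ≤ K ^ 2 * (|c| ^ 2 * v 2 ^ 2) := by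
      rw [show K ^ 2 * (|c| ^ 2 * v 2 ^ 2) = (K * |c|) ^ 2 * v 2 ^ 2 by ring]; exact le_mul_of_one_le_left (sq_nonneg _) hKc2
    linarith
  exact (pow_le_pow_iff_left₀ (norm_nonneg v) (mul_nonneg hK0 (norm_nonneg _)) two_ne_zero).1 hsq

end Summit.AtomisticToContinuum.Crystallization.Theorems.OverbindingBudgetAffineFarSmoothSplit
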